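import Literature.AnabelianGeometry.SemiGraphs.PSCSeparatingCoveringsThreeChainPointed
import Literature.AnabelianGeometry.SemiGraphs.PSCSeparatingCoveringsTwoComponentUnmarkedEdgesOneCusp
import Literature.AnabelianGeometry.SemiGraphs.PSCTwoComponentUnmarkedEdges
import HarnessLib

/-!
# [CombGC] Prop. 1.2, proof p. 9: EDGE-LIKE separating coverings at THREE-COMPONENT CHAINS with an UNMARKED MIDDLE component (row F-2827)

Mochizuki, *A combinatorial version of the Grothendieck conjecture*, Tohoku Math. J. **59** (2007)
[CombGC], PROOF of Proposition 1.2, author's manuscript p. 9, the resp'd (edge) case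
[cite: MochizukiCombGC2007, Prop 1.2 proof p.9]; typed LEVEL-WISE as `PSCDatum.EdgeLikeSeparatingCoverings`
(abc-iut-w4-d081, row P12-L01-E; abc-iut FACT-LIST row F-2827 — a schema whose universal closure is refuted as
typed; the instance forms at genuine carriers are the content).

PROOF-ONLY file (abc-iut-f-166 gen 6, row «UNMARKED-MIDDLE-CHAIN»; 0 definitions).  The carrier: abc-iut-f-164's
three-component chain shape `C₀ ∪_{ν_A} C_mid ∪_{ν_B} C₁` with the MIDDLE component UNMARKED: `s₁ = s₂ = s`,
`1 ≤ s < r` (the marked points `c_j`, `j ≥ s`, on `C₀`, the `c_j`, `j < s`, on `C₁`), `1 ≤ g₀ < g₁ < g` (the middle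
component carries the handles `g₀ ≤ i < g₁` and no marked point), over a profinite pro-`Σ` completion
`ι : Γ_{g,r} → Π`.  Here BOTH node loops are node-loop basis members — `ε_A` of the basis of `(g₀, s)`, `η` of the
basis of `(g₁, s)` — but of DIFFERENT bases (`η = ε_A · ∏_{g₀≤i<g₁}[a_i,b_i]`, so no free basis contains both).
Pairs of level edges: same node by gen 3's fibred twist in the respective basis, `c/c` likewise; every CROSS
pair through `IsProSigmaCompletion.exists_open_separating_of_hom` with Heisenberg quotients mod `ℓ^{[Π:V]}`
only: handle-cusp `(a_{i₀}, b_{i₀}, c_{j₀}) ↦ (X, Y, Z⁻¹)` at the middle handle `g₀` (`ε_A ↦ Z^{−[s≤j₀]}`,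
`η ↦ Z^{1−[s≤j₀]}`), at the handle `0` or `g₁` with `j₀ = k` (kills both loops, `c_k ↦ Z⁻¹`), and abc-iut-f-164's
two-handle quotient `(a_0, b_0, a_{g₁}, b_{g₁}) ↦ (X, Y, Y, X)` (kills every `c_j`; `ε_A, η ↦ Z`).

* `edgeLikeSeparatingCoverings_of_threeChain_unmarkedMid` — **F-2827** (`V' := V`) at EVERY such datum.

(The sub-corners `s = 0` / `s = r` — an end component unmarked as well — want the boundary-node theorem; not
in this file.)  Instance forms at data of the shape of genuine stable curves: consistency evidence for the typed
schema, not the printed theorem for all pointed stable curves.  Nothing here takes a side on [IUTchIII] Cor. 3.12.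
-/

noncomputable section

namespace Literature.AnabelianGeometry.SemiGraphs

namespace PSCDatum

open scoped Pointwise
open Multiplicative
open Literature.AnabelianGeometry.Anabelioids (IsSigmaInteger)
open Literature.GroupTheory.CombinatorialGroupTheory
open Literature.GroupTheory.CombinatorialGroupTheory.PuncturedSurfaceGroup (a b c cuspInertia
  exists_freeGroupBasis_nodeLoop exists_freeGroupBasis_eq_c exists_hom_handle_cusp hom_handle_cusp_nodeLoop
  exists_hom_two_handles hom_two_handles_nodeLoop)
open SemiGraphOfAnabelioids (IsProSigmaCompletion)
open SemiGraphOfAnabelioids.IsProSigmaCompletion (freeFactor_exists_open_separating_sameVertex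
  exists_open_separating_of_hom)

section ThreeChain

variable {P : Type} [Group P] [TopologicalSpace P] [IsTopologicalGroup P]
variable [CompactSpace P] [TotallyDisconnectedSpace P] {Sigma : Set ℕ} {g r : ℕ}

/-- **Row P12-L01-E / F-2827 (`EdgeLikeSeparatingCoverings`, `V' := V`) at EVERY three-component chain datum
whose MIDDLE component is UNMARKED** (`s₁ = s₂`, `1 ≤ s₁ < r`, `1 ≤ g₀ < g₁ < g`).
[cite: MochizukiCombGC2007, Prop 1.2 proof p.9] -/
theorem edgeLikeSeparatingCoverings_of_threeChain_unmarkedMid (hne : Sigma.Nonempty)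
    (hprime : ∀ p ∈ Sigma, p.Prime) (ι : PuncturedSurfaceGroup g r →* P)
    (hι : IsProSigmaCompletion Sigma ι) (G : PSCDatum P) {g₀ g₁ s₁ s₂ : ℕ} (hg₀ : 1 ≤ g₀) (hg : g₀ < g₁)
    (hg₁ : g₁ < g) (hs₁ : 1 ≤ s₁) (hs₁r : s₁ < r) (hs₂ : s₂ = s₁) (e : G.graph.C ≃ Fin r)
    (hC : ∀ c', G.cuspGp c' = ((cuspInertia (g := g) (e c')).map ι).topologicalClosure)
    (εA η : PuncturedSurfaceGroup g r)
    (hεA : εA = ((List.finRange r).map fun j : Fin r =>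
          if s₂ ≤ (j : ℕ) then PuncturedSurfaceGroup.c (g := g) j else 1).prod *
        ((List.finRange g).map fun i : Fin g => if (i : ℕ) < g₀ then
          PuncturedSurfaceGroup.a (r := r) i * PuncturedSurfaceGroup.b i *
            (PuncturedSurfaceGroup.a i)⁻¹ * (PuncturedSurfaceGroup.b i)⁻¹ else 1).prod)
    (hη : η = ((List.finRange r).map fun j : Fin r =>
          if s₁ ≤ (j : ℕ) then PuncturedSurfaceGroup.c (g := g) j else 1).prod *
        ((List.finRange g).map fun i : Fin g => if (i : ℕ) < g₁ then
          PuncturedSurfaceGroup.a (r := r) i * PuncturedSurfaceGroup.b i *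
            (PuncturedSurfaceGroup.a i)⁻¹ * (PuncturedSurfaceGroup.b i)⁻¹ else 1).prod)
    (nA nB : G.graph.N) (hN : ∀ n, n = nA ∨ n = nB)
    (hEA : G.nodeGp nA = ((Subgroup.zpowers εA).map ι).topologicalClosure)
    (hEB : G.nodeGp nB = ((Subgroup.zpowers η).map ι).topologicalClosure) :
    G.EdgeLikeSeparatingCoverings := by
  classical
  subst s₂
  obtain ⟨r', rfl⟩ : ∃ r', r = r' + 1 := ⟨r - 1, by omega⟩
  obtain ⟨ℓ, hℓS⟩ := hne
  have hℓ : ℓ.Prime := hprime ℓ hℓS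
  -- the two node-loop bases: `(g₀, s₁)` carries `ε_A`, `(g₁, s₁)` carries `η`
  obtain ⟨bA, -, -, -, hkA⟩ := exists_freeGroupBasis_nodeLoop g r' g₀ s₁ hs₁ (by omega) εA hεA
  obtain ⟨bB, -, -, -, hkB⟩ := exists_freeGroupBasis_nodeLoop g r' g₁ s₁ hs₁ (by omega) η hη
  have hslot : s₁ - 1 < r' := by omega
  -- the node generators
  obtain ⟨xs, hxs⟩ : ∃ f : G.graph.N → PuncturedSurfaceGroup g (r' + 1),
      f = fun n => if n = nA then εA else η := ⟨_, rfl⟩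
  have hxA : ∀ n, n = nA → xs n = εA := fun n hn => by rw [hxs]; exact if_pos hn
  have hxB : ∀ n, n ≠ nA → xs n = η := fun n hn => by rw [hxs]; exact if_neg hn
  have hEn : ∀ n, G.edgeGp (Sum.inl n) = ((Subgroup.zpowers (xs n)).map ι).topologicalClosure := by
    intro n
    change G.nodeGp n = _
    by_cases hn : n = nA
    · rw [hxA n hn, hn, hEA]
    · rcases hN n with h | h
      · exact absurd h hn
      · rw [hxB n hn, h, hEB]
  have hEc : ∀ c', G.edgeGp (Sum.inr c') = ((Subgroup.zpowers (c (e c'))).map ι).topologicalClosure :=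
    fun c' => hC c'
  have hEnA : ∀ n, n = nA → G.edgeGp (Sum.inl n) =
      ((Subgroup.closure (bA '' {Sum.inr ⟨s₁ - 1, hslot⟩})).map ι).topologicalClosure := fun n hn => by
    rw [hEn n, hxA n hn, Set.image_singleton, hkA, Subgroup.zpowers_eq_closure]
  have hEnB : ∀ n, n ≠ nA → G.edgeGp (Sum.inl n) =
      ((Subgroup.closure (bB '' {Sum.inr ⟨s₁ - 1, hslot⟩})).map ι).topologicalClosure := fun n hn => by
    rw [hEn n, hxB n hn, Set.image_singleton, hkB, Subgroup.zpowers_eq_closure]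
  have hιn : ∀ n, ι (xs n) ∈ G.edgeGp (Sum.inl n) := fun n => by
    rw [hEn]
    exact Subgroup.le_topologicalClosure _ (Subgroup.mem_map_of_mem ι (Subgroup.mem_zpowers _))
  have hιc : ∀ c', ι (c (e c')) ∈ G.edgeGp (Sum.inr c') := fun c' => by
    rw [hEc]
    exact Subgroup.le_topologicalClosure _ (Subgroup.mem_map_of_mem ι (Subgroup.mem_zpowers _))
  intro V hVn hVo
  haveI := hVn
  refine ⟨V, hVn, hVo, le_rfl, ?_⟩
  -- the finite `Σ`-targets mod `ℓ^m`, `m = [Π : V]`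
  have hVi : IsSigmaInteger Sigma V.index := hι.index_open V hVn hVo
  obtain ⟨m, hm⟩ : ∃ m : ℕ, m = V.index := ⟨_, rfl⟩
  have hmpos : 0 < m := by rw [hm]; exact hVi.1
  have hfin : ∀ {M : Type} [Group M] (u : M), u ^ m ≠ 1 → u ^ V.index ≠ 1 := fun u h => by rwa [← hm]
  have hmlt : m < ℓ ^ m := Nat.lt_pow_self hℓ.one_lt
  haveI : NeZero (ℓ ^ m) := ⟨pow_ne_zero _ hℓ.ne_zero⟩
  obtain ⟨φH, X, Y, Z, hXYZ, hZc, hZpow, hcard⟩ := Heisenberg.exists_heisenbergTriple_central (ℓ ^ m)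
  haveI : Finite (Multiplicative (ZMod (ℓ ^ m) × ZMod (ℓ ^ m)) ⋊[φH] Multiplicative (ZMod (ℓ ^ m))) :=
    Nat.finite_of_card_ne_zero (by rw [hcard]; exact pow_ne_zero _ (pow_ne_zero _ hℓ.ne_zero))
  have hHM : IsSigmaInteger Sigma
      (Nat.card (Multiplicative (ZMod (ℓ ^ m) × ZMod (ℓ ^ m)) ⋊[φH] Multiplicative (ZMod (ℓ ^ m)))) := by
    rw [hcard, ← pow_mul]
    exact Literature.AnabelianGeometry.SemiGraphs.isSigmaInteger_prime_pow hℓ hℓS _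
  have hZm : Z ^ m ≠ 1 := fun h => absurd (Nat.le_of_dvd hmpos ((hZpow m).mp h)) (not_le.mpr hmlt)
  have hZm' : Z⁻¹ ^ m ≠ 1 := by rw [inv_pow]; exact inv_ne_one.mpr hZm
  have hW : X * Y * X⁻¹ * Y⁻¹ * Z⁻¹ = 1 := by rw [hXYZ, mul_inv_cancel]
  have hZc' : X * Y * X⁻¹ * Y⁻¹ ∈ Subgroup.center _ := by rw [hXYZ]; exact hZc
  -- Heisenberg handle-cusp certificates: handle `i₀`, cusp `j₀ ↦ Z⁻¹`
  have hheis : ∀ (i₀ : Fin g) (j₀ : Fin (r' + 1)),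
      ∃ ψ : PuncturedSurfaceGroup g (r' + 1) →*
        Multiplicative (ZMod (ℓ ^ m) × ZMod (ℓ ^ m)) ⋊[φH] Multiplicative (ZMod (ℓ ^ m)),
        ψ (c j₀) = Z⁻¹ ∧ (∀ j, j ≠ j₀ → ψ (c j) = 1) ∧
          ψ εA = (if s₁ ≤ (j₀ : ℕ) then Z⁻¹ else 1) * (if (i₀ : ℕ) < g₀ then Z else 1) ∧
          ψ η = (if s₁ ≤ (j₀ : ℕ) then Z⁻¹ else 1) * (if (i₀ : ℕ) < g₁ then Z else 1) := by
    intro i₀ j₀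
    obtain ⟨ψ, ha', hb', hc', hab, hcj⟩ := exists_hom_handle_cusp (g := g) (r := r' + 1) i₀ j₀ X Y Z⁻¹ hW
    refine ⟨ψ, hc', hcj, ?_, ?_⟩
    · rw [hεA, hom_handle_cusp_nodeLoop ψ ha' hb' hc' hab hcj g₀ s₁, hXYZ]
    · rw [hη, hom_handle_cusp_nodeLoop ψ ha' hb' hc' hab hcj g₁ s₁, hXYZ]
  -- the two-handle certificate `(a_0, b_0, a_{g₁}, b_{g₁}) ↦ (X, Y, Y, X)`: kills every `c_j`, `ε_A, η ↦ Z`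
  have h0g₀ : ((⟨0, by omega⟩ : Fin g) : ℕ) < g₀ := by simp only; omega
  have h0g₁ : ((⟨0, by omega⟩ : Fin g) : ℕ) < g₁ := by simp only; omega
  have hm₀ : ¬ ((⟨g₀, by omega⟩ : Fin g) : ℕ) < g₀ := lt_irrefl _
  have hm₁ : ((⟨g₀, by omega⟩ : Fin g) : ℕ) < g₁ := by simp only; omega
  have hi₁ : ¬ ((⟨g₁, by omega⟩ : Fin g) : ℕ) < g₁ := lt_irrefl _
  have hi₁' : ¬ ((⟨g₁, by omega⟩ : Fin g) : ℕ) < g₀ := by simp only; omega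
  obtain ⟨ψ₂, ha₂, hb₂, -, -, hab₂, hcj₂⟩ := exists_hom_two_handles (g := g) (r := r' + 1) ⟨0, by omega⟩
    ⟨g₁, by omega⟩ (fun h => by have := congrArg Fin.val h; simp only at this; omega) X Y hZc'
  have hψ₂A : ψ₂ εA = Z := by
    rw [hεA, hom_two_handles_nodeLoop ψ₂ ha₂ hb₂ hab₂ hcj₂ g₀ s₁ h0g₀ (by simp only; omega), hXYZ]
  have hψ₂B : ψ₂ η = Z := by
    rw [hη, hom_two_handles_nodeLoop ψ₂ ha₂ hb₂ hab₂ hcj₂ g₁ s₁ h0g₁ (by simp only; exact le_rfl), hXYZ]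
  have hkill : ∀ {M : Type} [Group M] (φ : PuncturedSurfaceGroup g (r' + 1) →* M)
      (z : PuncturedSurfaceGroup g (r' + 1)), φ z = 1 → ∀ x ∈ Subgroup.zpowers z, φ x = 1 := by
    intro M _ φ z hz x hx
    obtain ⟨t, rfl⟩ := Subgroup.mem_zpowers_iff.mp hx
    rw [map_zpow, hz, one_zpow]
  -- one Heisenberg certificate killing BOTH node loops with `c_k ↦ Z⁻¹`
  have hcuspCert : ∀ k : Fin (r' + 1),
      ∃ ψ : PuncturedSurfaceGroup g (r' + 1) →*
        Multiplicative (ZMod (ℓ ^ m) × ZMod (ℓ ^ m)) ⋊[φH] Multiplicative (ZMod (ℓ ^ m)),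
        ψ (c k) = Z⁻¹ ∧ (∀ j, j ≠ k → ψ (c j) = 1) ∧ ψ εA = 1 ∧ ψ η = 1 := by
    intro k
    by_cases hk : s₁ ≤ (k : ℕ)
    · obtain ⟨ψ, hψk, hψj, hψA, hψB⟩ := hheis ⟨0, by omega⟩ k
      exact ⟨ψ, hψk, hψj, by rw [hψA, if_pos hk, if_pos h0g₀, inv_mul_cancel],
        by rw [hψB, if_pos hk, if_pos h0g₁, inv_mul_cancel]⟩
    · obtain ⟨ψ, hψk, hψj, hψA, hψB⟩ := hheis ⟨g₁, by omega⟩ k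
      exact ⟨ψ, hψk, hψj, by rw [hψA, if_neg hk, if_neg hi₁', mul_one], by rw [hψB, if_neg hk, if_neg hi₁, mul_one]⟩
  rintro (n₁ | c₁) (n₂ | c₂) γ₁ γ₂ hne12
  · -- node / node
    by_cases h12 : n₁ = n₂
    · subst h12
      have hne' := hne12.resolve_left fun h => h rfl
      by_cases h1 : n₁ = nA
      · have hA := hEnA n₁ h1
        exact freeFactor_exists_open_separating_sameVertex hι bA _ (Set.singleton_nonempty _) hℓ hℓS _ hA V
          hVo γ₁ γ₂ hne'
      · have hA := hEnB n₁ h1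
        exact freeFactor_exists_open_separating_sameVertex hι bB _ (Set.singleton_nonempty _) hℓ hℓS _ hA V
          hVo γ₁ γ₂ hne'
    · by_cases h1 : n₁ = nA
      · -- alive `ε_A`, killed `η`: Heisenberg at the middle handle `g₀` with the `C₀` cusp `c_{s₁}`
        have h2 : n₂ ≠ nA := fun h => h12 (h1.trans h.symm)
        obtain ⟨ψ, -, -, hψA, hψB⟩ := hheis ⟨g₀, by omega⟩ ⟨s₁, by omega⟩
        refine exists_open_separating_of_hom hι hHM ψ (G.edgeGp (Sum.inl n₂)) (Subgroup.zpowers (xs n₂))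
          (hEn n₂) (hkill ψ _ ?_) (G.edgeGp (Sum.inl n₁)) (xs n₁) (hιn n₁) V hVo ?_ γ₁ γ₂
        · rw [hxB n₂ h2, hψB, if_pos (show s₁ ≤ ((⟨s₁, _⟩ : Fin (r' + 1)) : ℕ) from le_rfl), if_pos hm₁,
            inv_mul_cancel]
        · rw [hxA n₁ h1, hψA, if_pos (show s₁ ≤ ((⟨s₁, _⟩ : Fin (r' + 1)) : ℕ) from le_rfl), if_neg hm₀, mul_one]
          exact hfin _ hZm'
      · -- alive `η`, killed `ε_A`: Heisenberg at the middle handle `g₀` with the `C₁` cusp `c_0`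
        have h2 : n₂ = nA := by
          rcases hN n₂ with h | h
          · exact h
          · rcases hN n₁ with h' | h'
            · exact absurd h' h1
            · exact absurd (h'.trans h.symm) h12
        obtain ⟨ψ, -, -, hψA, hψB⟩ := hheis ⟨g₀, by omega⟩ ⟨0, by omega⟩
        refine exists_open_separating_of_hom hι hHM ψ (G.edgeGp (Sum.inl n₂)) (Subgroup.zpowers (xs n₂))
          (hEn n₂) (hkill ψ _ ?_) (G.edgeGp (Sum.inl n₁)) (xs n₁) (hιn n₁) V hVo ?_ γ₁ γ₂
        · rw [hxA n₂ h2, hψA, if_neg (show ¬ s₁ ≤ ((⟨0, _⟩ : Fin (r' + 1)) : ℕ) by simp only; omega), if_neg hm₀,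
            mul_one]
        · rw [hxB n₁ h1, hψB, if_neg (show ¬ s₁ ≤ ((⟨0, _⟩ : Fin (r' + 1)) : ℕ) by simp only; omega), if_pos hm₁,
            one_mul]
          exact hfin _ hZm
  · -- alive: a node; killed: the cusp `k = e c₂` — the two-handle certificate
    refine exists_open_separating_of_hom hι hHM ψ₂ (G.edgeGp (Sum.inr c₂)) (Subgroup.zpowers (c (e c₂)))
      (hEc c₂) (hkill ψ₂ _ (hcj₂ _)) (G.edgeGp (Sum.inl n₁)) (xs n₁) (hιn n₁) V hVo ?_ γ₁ γ₂
    by_cases h1 : n₁ = nA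
    · rw [hxA n₁ h1, hψ₂A]; exact hfin _ hZm
    · rw [hxB n₁ h1, hψ₂B]; exact hfin _ hZm
  · -- alive: the cusp `k = e c₁`; killed: a node — one Heisenberg certificate kills both loops
    obtain ⟨ψ, hψk, -, hψA, hψB⟩ := hcuspCert (e c₁)
    refine exists_open_separating_of_hom hι hHM ψ (G.edgeGp (Sum.inl n₂)) (Subgroup.zpowers (xs n₂)) (hEn n₂)
      (hkill ψ _ ?_) (G.edgeGp (Sum.inr c₁)) (c (e c₁)) (hιc c₁) V hVo (by rw [hψk]; exact hfin _ hZm') γ₁ γ₂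
    by_cases h2 : n₂ = nA
    · rw [hxA n₂ h2, hψA]
    · rw [hxB n₂ h2, hψB]
  · -- cusp / cusp
    by_cases h12 : c₁ = c₂
    · subst h12
      have hne' := hne12.resolve_left fun h => h rfl
      obtain ⟨β, bs, k, hk⟩ := exists_freeGroupBasis_eq_c (g := g) (by omega : 2 ≤ r' + 1) (e c₁)
      have hform : G.edgeGp (Sum.inr c₁) = ((Subgroup.closure (bs '' {k})).map ι).topologicalClosure := by
        rw [hEc, Set.image_singleton, hk, Subgroup.zpowers_eq_closure]
      exact freeFactor_exists_open_separating_sameVertex hι bs _ (Set.singleton_nonempty _) hℓ hℓS _ hform V hVo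
        γ₁ γ₂ hne'
    · have hkm : e c₁ ≠ e c₂ := fun h => h12 (e.injective h)
      obtain ⟨ψ, hψk, hψj, -, -⟩ := hcuspCert (e c₁)
      exact exists_open_separating_of_hom hι hHM ψ (G.edgeGp (Sum.inr c₂)) (Subgroup.zpowers (c (e c₂)))
        (hEc c₂) (hkill ψ _ (hψj _ hkm.symm)) (G.edgeGp (Sum.inr c₁)) (c (e c₁)) (hιc c₁) V hVo
        (by rw [hψk]; exact hfin _ hZm') γ₁ γ₂

end ThreeChain

end PSCDatum

end Literature.AnabelianGeometry.SemiGraphs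

end
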